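/-
Origin: expansion seat `prover-pub-hodgecm-mc-binder-2-g14-0`, handover #75 r2 2026-08-20T09:12Z md5 8ff0a6d8bcf3 (290 l.; 16 s; imports #74 `KappaIota`, theta-3 `Model/ArchSlotDatumDefinite` (RUN 42) + `Model/ArchLineCenterCharClosedForm` (RUN 41); (V-val) AT THE ι₁ SLOT, CLOSED IN THE POSITIVE W-READING: §1 block shape at v₁ (`nonempty_posIdx_cmXV_cmPlace`, `subsingleton_negIdx_cmXV_cmPlace` from carch-1 `blockPosEquiv`/`blockNegEquiv`; `nonempty_posIdx_cmXW_cmPlace_of_pos`, `isEmpty_negIdx_cmXW_cmPlace_of_pos`, cards 2/0) and **`exists_pairSlotDatum_cmPlace_of_pos`**: the PAIR's small archimedean Weil datum at v₁ EXISTS (slot `U(2,1)×U(2,0)`; theta-3 `ArchSideTerm.exists_slotDatum_of_negCard` = tree `isArchWeilDatum_linWeil_neg_card`, unconditional) — NO new hypothesis; §2 `pinSigns`, **`iotaVacExponents hGR hW hpos`** (= binder-2 `placeVacExponents` of record at v₁, canonical block frame, that datum), **`pinLetterChar_mulSingle_cmPlace`** (`pinLetterChar (mulSingle v₁ k) = vacScalar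 (iotaVacExponents) k`; (CF)'s one-place argument: `follandFock_one_eq_blockFrame` + #19 `cmArchWeilRep_κ_binvPi`), **`iotaVacExponents_eP_sub_eQ`** (`e_P − e_Q = 2`, `placeVacExponents_eP_sub_eQ` [KonnoKonno2007 Lemma 5.2]), **`pinLetterChar_kVLetters_mulSingle_cmPlace_eq_det_zpow`** (THE CLOSED FORM `pinLetterChar (kVLetters (mulSingle v₁ (A,D))) = det A^{e_P}·det D^{e_Q}`); §3 `dVIota_eq_det` (= det A, pos reading), `det_negLetter_eq`, `zpow_bookkeeping`, **`hκ₁_of_type_of_pos`**: #73's ι₁ residual `hκ₁` HOLDS given `HasArchType χV nV`, the positive W-reading at v₁, the canonical-representative guard `(mk ι₁).embedding = ι₁` and the (S-norm) normalisation AT v₁ `nV (w v₁) = −(iotaVacExponents).eP` (via #74 `hκ₁_iff_letterChar`; the identity is `e_Q = e_P − 2`); §4 **`hκ_of_type_of_pos`**: E's hypothesis family `hκ` of #51/#61/#70/#71 VERBATIM (every `k ∈ K_∞`) from the TYPE EQUATIONS ALONE (`nV (w b) = −pairVacExponent b` off v₁, `nV (w v₁) = −e_P(v₁)`) + positive reading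 + guard — (V-val) is now an (S-norm) statement at every real place; NAME LIST `HodgeCM.Model.HypCensus.` × {exists_pairSlotDatum_cmPlace_of_pos, iotaVacExponents, pinLetterChar_mulSingle_cmPlace, iotaVacExponents_eP_sub_eQ, pinLetterChar_kVLetters_mulSingle_cmPlace_eq_det_zpow, hκ₁_of_type_of_pos, hκ_of_type_of_pos}) (`HOME/mc/pub-hodgecm-mc-binder-2/g14/pkg/HodgeCM/Model/HypCensus/KappaSlot.lean`, md5 8ff0a6d8bcf3, 290 lines);
landed by the second packager p2 gen 5 (p2-g5) in gate run 46 as `HodgeCM/Model/HypCensus/KappaSlot.lean` (verbatim).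
-/
/-
Copyright (c) 2026. All rights reserved.
Released under Apache 2.0 license as described in the file LICENSE.
-/
import Summits.HodgeConjecture.HodgeCM.Model.HypCensus.KappaIota
import Summits.HodgeConjecture.HodgeCM.Model.ArchSlotDatumDefinite
import Summits.HodgeConjecture.HodgeCM.Model.ArchLineCenterCharClosedForm

/-!
# (V-val) at the `ι₁` slot, CLOSED: the pair's small Weil datum at `v₁`, the closed form of the pin's letter character there,
# and `hκ₁` from the type normalisation (positive `W`-reading, canonical representative)

Binder-2 lineage, rows 18/19 (`hyp12`/`hyp34`).  After #74 `hκ₁_iff_letterChar` the residual of (V-val) is the closed form of the pin's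
letter character on the `ι₁`-letters `(A, D) ∈ U(V⁺_{v₁}) × U(V⁻_{v₁}) ≅ U(2) × U(1)`.  This leaf supplies it:

* §1 the block shape at `v₁`: `V⁺_{v₁}` has a point and `V⁻_{v₁}` is a subsingleton (carch-1 `blockPosEquiv`/`blockNegEquiv`); in the
  POSITIVE `W`-reading (`∀ j, 0 < x_W(v₁) j`) `W⁺_{v₁}` has a point and `W⁻_{v₁}` is empty, so the slot at `v₁` has shape
  `U(2,1) × U(2,0)` and **`exists_pairSlotDatum_cmPlace_of_pos`**: its small archimedean Weil datum EXISTS — theta-3's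
  `ArchSideTerm.exists_slotDatum_of_negCard` (= the tree's UNCONDITIONAL linearised datum `isArchWeilDatum_linWeil_neg_card`,
  [Folland1989, §4.2 (4.24), Prop. (4.39)], radial-ladder proof of the vacuum-overlap phase).  No hypothesis.
* §2 **`iotaVacExponents`** := binder-2's `placeVacExponents` OF RECORD at `v₁` (canonical block frame, that slot datum), and
  **`pinLetterChar_mulSingle_cmPlace`**: `pinLetterChar (mulSingle v₁ k) = vacScalar (iotaVacExponents) k` — (CF)'s one-place argument
  (`ArchSideTerm.character_mulSingle_eq_vacScalar`: the vacuum is the block pure tensor at `v₁`, binder-2 #19 `cmArchWeilRep_κ_binvPi`);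
  hence **`pinLetterChar_kVLetters_mulSingle_cmPlace_eq_det_zpow`**: `pinLetterChar (kVLetters (mulSingle v₁ (A, D))) = det A^{e_P} · det D^{e_Q}` and the
  PINNED DIFFERENCE **`iotaVacExponents_eP_sub_eQ`**: `e_P − e_Q = |W⁺_{v₁}| − |W⁻_{v₁}| = 2` ([KonnoKonno2007, Lemma 5.2]: `placeVacExponents_eP_sub_eQ`).
* §3 **`hκ₁_of_type_of_pos`**: for `χ_V` of archimedean type `n_V` with the (S-norm) normalisation AT `v₁`, `n_V (w v₁) = −e_P(v₁)`, in the positive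
  `W`-reading and for the canonical representative `(mk ι₁).embedding = ι₁` (E's guard `hcan`), the `ι₁` residual `hκ₁` of #73 HOLDS:
  `(det A·det D)^{n_V} · det A^{e_P} det D^{e_Q} · det A = det A · det D / (det D)³` is the integer identity `e_Q = e_P − 2`.
* §4 **`hκ_of_type_of_pos`**: #73 `hκ_of_iota_of_type` with `hκ₁` discharged — E's hypothesis family `hκ` (#51/#61/#70/#71 verbatim, all
  `k ∈ K_∞`) from the type equations `n_V (w b) = −pairVacExponent b` (`b ≠ v₁`), `n_V (w v₁) = −e_P(v₁)` alone (positive reading, guard).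

What is NOT here: the negative `W`-reading at `v₁` (slot shape `U(2,1) × U(0,2)`: no small datum in the tree — the vacuum-overlap phase
`(★★)` is proved for `W⁻ = 0` only); at E's good contexts with the bit of record `orientBitι` and the guard `hcan` the reading is positive
(separate leaf).  Nothing here is a claim of PerL/QW8; bracketed references are provenance of the tree theorems used.
-/

noncomputable section

open NumberField NumberField.InfinitePlace IsDedekindDomain
open scoped Matrix Classical TensorProduct
open MvPolynomial
open Literature.NumberTheory.Automorphic Literature.NumberTheory.Automorphic.UnitaryGroup Literature.NumberTheory.Weil1964
open Literature.RepresentationTheory.KonnoKonno2007 Literature.RepresentationTheory.KonnoKonno2007.RealDualPair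
open Literature.NumberTheory.GelbartRogawski1991 Literature.NumberTheory.GelbartRogawski1991.UnitaryDualPair
open Literature.Analysis.SegalBargmann
open HodgeCM HodgeCM.Model HodgeCM.Adelic
open HodgeCM.Model.ArchSideTerm (follandFock_one_ne_zero cmBlockSectionAt_refl_κ follandFock_one_eq_blockFrame exists_slotDatum_of_negCard)

namespace HodgeCM.Model.HypCensus

/-! ## §1 The block shape at `v₁` and the pair's small Weil datum there (positive `W`-reading) -/

section Slot

variable {L : CMField} {ι₁ : L →+* ℂ} (V : HermSpace3 L ι₁) (S : StubTree.SeesawDatum L)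

/-- `V⁺_{v₁}` has a point (`σ 0`). -/
theorem nonempty_posIdx_cmXV_cmPlace :
    Nonempty (PosIdx (cmXV (L : Type) (frameD V) (frameD_real V) ι₁ (cmPlace (L : Type) ι₁))) :=
  ⟨(blockPosEquiv V).symm 0⟩

/-- `V⁻_{v₁}` is a subsingleton (`{σ 2}`). -/
theorem subsingleton_negIdx_cmXV_cmPlace :
    Subsingleton (NegIdx (cmXV (L : Type) (frameD V) (frameD_real V) ι₁ (cmPlace (L : Type) ι₁))) :=
  (blockNegEquiv V).subsingleton

/-- the point `σ 2` of `V⁻_{v₁}`. -/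
def iotaNegPt : NegIdx (cmXV (L : Type) (frameD V) (frameD_real V) ι₁ (cmPlace (L : Type) ι₁)) := (blockNegEquiv V).symm ()

/-- in the positive `W`-reading `W⁺_{v₁}` has a point. -/
theorem nonempty_posIdx_cmXW_cmPlace_of_pos (hpos : ∀ j, 0 < cmXW (L : Type) (frameD V) (dW S) (dW_real S) ι₁ (cmPlace (L : Type) ι₁) j) :
    Nonempty (PosIdx (cmXW (L : Type) (frameD V) (dW S) (dW_real S) ι₁ (cmPlace (L : Type) ι₁))) :=
  ⟨⟨0, hpos 0⟩⟩

/-- in the positive `W`-reading `W⁻_{v₁}` is empty. -/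
theorem isEmpty_negIdx_cmXW_cmPlace_of_pos (hpos : ∀ j, 0 < cmXW (L : Type) (frameD V) (dW S) (dW_real S) ι₁ (cmPlace (L : Type) ι₁) j) :
    IsEmpty (NegIdx (cmXW (L : Type) (frameD V) (dW S) (dW_real S) ι₁ (cmPlace (L : Type) ι₁))) :=
  ⟨fun q => q.2 (hpos q.1)⟩

/-- in the positive `W`-reading `|W⁺_{v₁}| = 2`. -/
theorem card_posIdx_cmXW_cmPlace_of_pos (hpos : ∀ j, 0 < cmXW (L : Type) (frameD V) (dW S) (dW_real S) ι₁ (cmPlace (L : Type) ι₁) j) :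
    Fintype.card (PosIdx (cmXW (L : Type) (frameD V) (dW S) (dW_real S) ι₁ (cmPlace (L : Type) ι₁))) = 2 := by
  rw [Fintype.card_congr (Equiv.subtypeUnivEquiv hpos), Fintype.card_fin]

/-- in the positive `W`-reading `|W⁻_{v₁}| = 0`. -/
theorem card_negIdx_cmXW_cmPlace_of_pos (hpos : ∀ j, 0 < cmXW (L : Type) (frameD V) (dW S) (dW_real S) ι₁ (cmPlace (L : Type) ι₁) j) :
    Fintype.card (NegIdx (cmXW (L : Type) (frameD V) (dW S) (dW_real S) ι₁ (cmPlace (L : Type) ι₁))) = 0 :=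
  @Fintype.card_eq_zero _ _ (isEmpty_negIdx_cmXW_cmPlace_of_pos V S hpos)

/-- **THE PAIR'S SMALL WEIL DATUM AT `v₁` EXISTS (positive `W`-reading)**: slot shape `U(2,1) × U(2,0)`, theta-3's
`exists_slotDatum_of_negCard` = the tree's unconditional linearised datum. [Folland1989, §4.2 (4.24), Prop. (4.39); KonnoKonno2007, §3.1] -/
theorem exists_pairSlotDatum_cmPlace_of_pos (hpos : ∀ j, 0 < cmXW (L : Type) (frameD V) (dW S) (dW_real S) ι₁ (cmPlace (L : Type) ι₁) j) :
    ∃ ω₁ : Representation ℂ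
        (Ginf (PosIdx (cmXV (L : Type) (frameD V) (frameD_real V) ι₁ (cmPlace (L : Type) ι₁)))
          (NegIdx (cmXV (L : Type) (frameD V) (frameD_real V) ι₁ (cmPlace (L : Type) ι₁)))
          (PosIdx (cmXW (L : Type) (frameD V) (dW S) (dW_real S) ι₁ (cmPlace (L : Type) ι₁)))
          (NegIdx (cmXW (L : Type) (frameD V) (dW S) (dW_real S) ι₁ (cmPlace (L : Type) ι₁))))
        (SchwartzMap (DPIdx (PosIdx (cmXV (L : Type) (frameD V) (frameD_real V) ι₁ (cmPlace (L : Type) ι₁)))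
          (NegIdx (cmXV (L : Type) (frameD V) (frameD_real V) ι₁ (cmPlace (L : Type) ι₁)))
          (PosIdx (cmXW (L : Type) (frameD V) (dW S) (dW_real S) ι₁ (cmPlace (L : Type) ι₁)))
          (NegIdx (cmXW (L : Type) (frameD V) (dW S) (dW_real S) ι₁ (cmPlace (L : Type) ι₁))) → ℝ) ℂ),
      IsArchWeilDatum (ι𝕎 _ _ _ _) ω₁ ∧ ∀ u, Continuous (ω₁ u) := by
  haveI := subsingleton_negIdx_cmXV_cmPlace V
  haveI := nonempty_posIdx_cmXW_cmPlace_of_pos V S hpos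
  haveI := isEmpty_negIdx_cmXW_cmPlace_of_pos V S hpos
  exact exists_slotDatum_of_negCard ((blockPosEquiv V).symm 0) (iotaNegPt V)

end Slot

/-! ## §2 The vacuum exponents of record at `v₁` and the closed form of the pin's letter character there -/

section Char

variable {L : CMField} {ι₁ : L →+* ℂ} (V : HermSpace3 L ι₁) (S : StubTree.SeesawDatum L)
variable
  (hGR : (cmSplittingDatum (L : Type) finProdFinEquiv (frameD V) (frameD_real V) (frameD_ne V) (dW S) (dW_real S) (dW_ne S)).CompatibleSplitting)
  (hW : (∀ j, 0 < (ι₁ ((dW S) j)).re) ∨ ∀ j, (ι₁ ((dW S) j)).re < 0)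

include hW in
/-- the four sign facts of the pin, bundled as `placeVacExponents` consumes them (`h₁V`, `h₁W = hW`, `hV`, `hW'` via `signs_fin_two`). -/
theorem pinSigns :
    (∃ i₀ : Fin 3, (∀ i, i ≠ i₀ → 0 < (ι₁ (frameD V i)).re) ∨ ∀ i, i ≠ i₀ → (ι₁ (frameD V i)).re < 0) ∧
      ((∀ j, 0 < (ι₁ ((dW S) j)).re) ∨ ∀ j, (ι₁ ((dW S) j)).re < 0) ∧
      (∀ τ : (L : Type) →+* ℂ, InfinitePlace.mk τ ≠ InfinitePlace.mk ι₁ →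
        (∀ i, 0 < (τ (frameD V i)).re) ∨ ∀ i, (τ (frameD V i)).re < 0) ∧
      (∀ τ : (L : Type) →+* ℂ, InfinitePlace.mk τ ≠ InfinitePlace.mk ι₁ →
        (∃ j₀ : Fin 2, ∀ j, j ≠ j₀ → 0 < (τ ((dW S) j)).re) ∨ ∀ j, (τ ((dW S) j)).re < 0) :=
  ⟨frameD_sign_ι₁' V, hW, frameD_sign_of_ne V,
    fun τ' _ => signs_fin_two fun j => re_apply_ne_zero_of_complexConj_eq (L : Type) τ' (dW_real S j) (dW_ne S j)⟩

/-- **THE VACUUM EXPONENT TUPLE OF RECORD AT `v₁`** (positive `W`-reading): binder-2's `placeVacExponents` at the place under `ι₁`, canonical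
block frame, the slot datum of §1. -/
def iotaVacExponents (hpos : ∀ j, 0 < cmXW (L : Type) (frameD V) (dW S) (dW_real S) ι₁ (cmPlace (L : Type) ι₁) j) : VacExponents :=
  placeVacExponents (L : Type) finProdFinEquiv (frameD V) (frameD_real V) (frameD_ne V) (dW S) (dW_real S) (dW_ne S) hGR ι₁
    (cmPlace (L : Type) ι₁) (Equiv.refl _) (Equiv.refl _) (Equiv.refl _) (Equiv.refl _) (pinSigns V S hW)
    (exists_pairSlotDatum_cmPlace_of_pos V S hpos)

/-- **THE PIN'S LETTER CHARACTER ON A `v₁`-LETTER IS THE VACUUM SCALAR OF RECORD** ((CF)'s one-place argument at `v₁`: the vacuum is the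
block pure tensor `F_{v₁}⁻¹(B⁻¹1 ⊠ B⁻¹1)`, binder-2 #19 `cmArchWeilRep_κ_binvPi`). [Folland1989, Prop. (4.39); KonnoKonno2007, Lemma 5.2] -/
theorem pinLetterChar_mulSingle_cmPlace (hpos : ∀ j, 0 < cmXW (L : Type) (frameD V) (dW S) (dW_real S) ι₁ (cmPlace (L : Type) ι₁) j)
    (k : DPK (PosIdx (cmXV (L : Type) (frameD V) (frameD_real V) ι₁ (cmPlace (L : Type) ι₁)))
      (NegIdx (cmXV (L : Type) (frameD V) (frameD_real V) ι₁ (cmPlace (L : Type) ι₁)))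
      (PosIdx (cmXW (L : Type) (frameD V) (dW S) (dW_real S) ι₁ (cmPlace (L : Type) ι₁)))
      (NegIdx (cmXW (L : Type) (frameD V) (dW S) (dW_real S) ι₁ (cmPlace (L : Type) ι₁)))) :
    ((pinLetterChar V S hGR hW (Pi.mulSingle (cmPlace (L : Type) ι₁) k) : Circle) : ℂ) = vacScalar (iotaVacExponents V S hGR hW hpos) k := by
  have h1 := cmArchWeilRep_letterSection_follandFock_one (L : Type) (frameD V) (frameD_real V) (frameD_ne V) (dW S) (dW_real S) (dW_ne S)
    hGR ι₁ (frameD_sign_ι₁' V) hW (frameD_sign_of_ne V)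
    (fun τ' _ => signs_fin_two fun j => re_apply_ne_zero_of_complexConj_eq (L : Type) τ' (dW_real S j) (dW_ne S j))
    (Pi.mulSingle (cmPlace (L : Type) ι₁) k)
  rw [letterSection_mulSingle, ← cmBlockSectionAt_refl_κ,
    follandFock_one_eq_blockFrame (L : Type) finProdFinEquiv (frameD V) (frameD_real V) (frameD_ne V) (dW S) (dW_real S) (dW_ne S) ι₁
      (cmPlace (L : Type) ι₁),
    cmArchWeilRep_κ_binvPi (L : Type) finProdFinEquiv (frameD V) (frameD_real V) (frameD_ne V) (dW S) (dW_real S) (dW_ne S) hGR ι₁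
      (cmPlace (L : Type) ι₁) (Equiv.refl _) (Equiv.refl _) (Equiv.refl _) (Equiv.refl _) (pinSigns V S hW)
      (exists_pairSlotDatum_cmPlace_of_pos V S hpos) k, map_one] at h1
  have hΩ : (cmBlockFrameAt (L : Type) finProdFinEquiv (frameD V) (frameD_real V) (frameD_ne V) (dW S) (dW_real S) (dW_ne S) ι₁
      (cmPlace (L : Type) ι₁) (Equiv.refl _) (Equiv.refl _) (Equiv.refl _) (Equiv.refl _)).symm
      (tensorPi (binvPi (1 : MvPolynomial _ ℂ)) (binvPi (1 : MvPolynomial _ ℂ))) ≠ 0 := by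
    rw [← follandFock_one_eq_blockFrame (L : Type) finProdFinEquiv (frameD V) (frameD_real V) (frameD_ne V) (dW S) (dW_real S) (dW_ne S) ι₁
      (cmPlace (L : Type) ι₁)]
    exact follandFock_one_ne_zero _
  exact (smul_left_injective ℂ hΩ h1).symm

/-- **THE PINNED DIFFERENCE AT `v₁`**: `e_P − e_Q = |W⁺_{v₁}| − |W⁻_{v₁}| = 2`. [KonnoKonno2007, Lemma 5.2] -/
theorem iotaVacExponents_eP_sub_eQ (hpos : ∀ j, 0 < cmXW (L : Type) (frameD V) (dW S) (dW_real S) ι₁ (cmPlace (L : Type) ι₁) j) :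
    (iotaVacExponents V S hGR hW hpos).eP - (iotaVacExponents V S hGR hW hpos).eQ = 2 := by
  unfold iotaVacExponents
  have h := placeVacExponents_eP_sub_eQ (L : Type) finProdFinEquiv (frameD V) (frameD_real V) (frameD_ne V) (dW S) (dW_real S) (dW_ne S)
    hGR ι₁ (cmPlace (L : Type) ι₁) (Equiv.refl _) (Equiv.refl _) (Equiv.refl _) (Equiv.refl _) (pinSigns V S hW)
    (exists_pairSlotDatum_cmPlace_of_pos V S hpos) ((blockPosEquiv V).symm 0) (iotaNegPt V)
  rw [card_posIdx_cmXW_cmPlace_of_pos V S hpos, card_negIdx_cmXW_cmPlace_of_pos V S hpos] at h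
  simpa using h

/-- **THE LETTER CHARACTER ON THE `ι₁`-LETTERS, CLOSED FORM**: `pinLetterChar (kVLetters (mulSingle v₁ (A, D))) = det A^{e_P} · det D^{e_Q}`.
[Folland1989, Prop. (4.39); KonnoKonno2007, Lemma 5.2] -/
theorem pinLetterChar_kVLetters_mulSingle_cmPlace_eq_det_zpow (hpos : ∀ j, 0 < cmXW (L : Type) (frameD V) (dW S) (dW_real S) ι₁ (cmPlace (L : Type) ι₁) j)
    (x : Matrix.unitaryGroup (PosIdx (cmXV (L : Type) (frameD V) (frameD_real V) ι₁ (cmPlace (L : Type) ι₁))) ℂ ×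
      Matrix.unitaryGroup (NegIdx (cmXV (L : Type) (frameD V) (frameD_real V) ι₁ (cmPlace (L : Type) ι₁))) ℂ) :
    ((pinLetterChar V S hGR hW (kVLetters V S (Pi.mulSingle (cmPlace (L : Type) ι₁) x)) : Circle) : ℂ) =
      (x.1 : Matrix (PosIdx (cmXV (L : Type) (frameD V) (frameD_real V) ι₁ (cmPlace (L : Type) ι₁))) (PosIdx (cmXV (L : Type) (frameD V) (frameD_real V) ι₁ (cmPlace (L : Type) ι₁))) ℂ).det ^ (iotaVacExponents V S hGR hW hpos).eP *
        (x.2 : Matrix (NegIdx (cmXV (L : Type) (frameD V) (frameD_real V) ι₁ (cmPlace (L : Type) ι₁))) (NegIdx (cmXV (L : Type) (frameD V) (frameD_real V) ι₁ (cmPlace (L : Type) ι₁))) ℂ).det ^ (iotaVacExponents V S hGR hW hpos).eQ := by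
  rw [kVLetters_mulSingle, pinLetterChar_mulSingle_cmPlace V S hGR hW hpos]
  simp only [vacScalar, Prod.fst_one, Prod.snd_one, OneMemClass.coe_one, Matrix.det_one, one_zpow, mul_one]

end Char

/-! ## §3 `hκ₁` from the type normalisation at `v₁` (positive `W`-reading, canonical representative) -/

section Iota

variable {L : CMField} {ι₁ : L →+* ℂ} (V : HermSpace3 L ι₁) (S : StubTree.SeesawDatum L)
variable
  (hGR : (cmSplittingDatum (L : Type) finProdFinEquiv (frameD V) (frameD_real V) (frameD_ne V) (dW S) (dW_real S) (dW_ne S)).CompatibleSplitting)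
  (hW : (∀ j, 0 < (ι₁ ((dW S) j)).re) ∨ ∀ j, (ι₁ ((dW S) j)).re < 0)
variable (χV χW : ContinuousMonoidHom
  (Literature.NumberTheory.Automorphic.relNormOneIdeles (↥(maximalRealSubfield L)) (L : Type) ⧸
    Literature.NumberTheory.Automorphic.relNormOneRat (↥(maximalRealSubfield L)) (L : Type)) Circle)
variable {nV : InfinitePlace (L : Type) → ℤ}

/-- `dVIota (A, D) = det A` in the positive `W`-reading. -/
theorem dVIota_eq_det (hpos : ∀ j, 0 < cmXW (L : Type) (frameD V) (dW S) (dW_real S) ι₁ (cmPlace (L : Type) ι₁) j)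
    (x : Matrix.unitaryGroup (PosIdx (cmXV (L : Type) (frameD V) (frameD_real V) ι₁ (cmPlace (L : Type) ι₁))) ℂ ×
      Matrix.unitaryGroup (NegIdx (cmXV (L : Type) (frameD V) (frameD_real V) ι₁ (cmPlace (L : Type) ι₁))) ℂ) :
    dVIota V S x = (x.1 : Matrix (PosIdx (cmXV (L : Type) (frameD V) (frameD_real V) ι₁ (cmPlace (L : Type) ι₁))) (PosIdx (cmXV (L : Type) (frameD V) (frameD_real V) ι₁ (cmPlace (L : Type) ι₁))) ℂ).det := by
  rw [dVIota_eq_det_of_pos V S hpos, vcMatrix_eq, Matrix.det_transpose, Matrix.det_submatrix_equiv_self]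

/-- the determinant of a `V⁻_{v₁}`-letter is its entry at `σ 2` (`V⁻_{v₁}` is the point `q₀`). -/
theorem det_negLetter_eq (q₀ : NegIdx (cmXV (L : Type) (frameD V) (frameD_real V) ι₁ (cmPlace (L : Type) ι₁)))
    (D : Matrix.unitaryGroup (NegIdx (cmXV (L : Type) (frameD V) (frameD_real V) ι₁ (cmPlace (L : Type) ι₁))) ℂ) :
    (D : Matrix (NegIdx (cmXV (L : Type) (frameD V) (frameD_real V) ι₁ (cmPlace (L : Type) ι₁))) (NegIdx (cmXV (L : Type) (frameD V) (frameD_real V) ι₁ (cmPlace (L : Type) ι₁))) ℂ).det = (D : Matrix (NegIdx (cmXV (L : Type) (frameD V) (frameD_real V) ι₁ (cmPlace (L : Type) ι₁))) (NegIdx (cmXV (L : Type) (frameD V) (frameD_real V) ι₁ (cmPlace (L : Type) ι₁))) ℂ) q₀ q₀ := by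
  haveI := subsingleton_negIdx_cmXV_cmPlace V
  letI : Unique (NegIdx (cmXV (L : Type) (frameD V) (frameD_real V) ι₁ (cmPlace (L : Type) ι₁))) := ⟨⟨q₀⟩, fun a => Subsingleton.elim _ _⟩
  rw [Matrix.det_unique, show (default : NegIdx (cmXV (L : Type) (frameD V) (frameD_real V) ι₁ (cmPlace (L : Type) ι₁))) = q₀ from
    Subsingleton.elim _ _]

/-- the integer bookkeeping of `hκ₁`: `(a d)^{−e} · (a^{e} · d^{e−2}) · a = a d / d³`. -/
theorem zpow_bookkeeping {a d : ℂ} (ha : a ≠ 0) (hd : d ≠ 0) (e : ℤ) :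
    (a * d) ^ (-e) * (a ^ e * d ^ (e - 2)) * a = a * d / d ^ 3 := by
  have h1 : (a * d) ^ (-e) * (a ^ e * d ^ (e - 2)) * a = (a ^ (-e) * a ^ e) * (d ^ (-e) * d ^ (e - 2)) * a := by
    rw [mul_zpow]; ring
  rw [h1, ← zpow_add₀ ha, ← zpow_add₀ hd, neg_add_cancel, zpow_zero, one_mul, show -e + (e - 2) = -2 by ring,
    show (-2 : ℤ) = -((2 : ℕ) : ℤ) by norm_num, zpow_neg, zpow_natCast]
  field_simp

/-- **`hκ₁` FROM THE TYPE NORMALISATION AT `v₁`.**  For E's `η = (χ_V ∘ det_V)·(χ_W ∘ det_W)` with `χ_V` of archimedean type `n_V`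
normalised AT `v₁` by `n_V (w v₁) = −e_P(v₁)` (`iotaVacExponents`), in the positive `W`-reading and for the canonical representative
`(mk ι₁).embedding = ι₁`, the `ι₁` residual of (V-val) (#73's `hκ₁`) holds on every `ι₁`-letter.
[GelbartRogawski1991, §3.1 Remark p. 457; Folland1989, Prop. (4.39); KonnoKonno2007, Lemma 5.2] -/
theorem hκ₁_of_type_of_pos (hnV : UnitaryLineChar.HasArchType (L : Type) χV nV)
    (hpos : ∀ j, 0 < cmXW (L : Type) (frameD V) (dW S) (dW_real S) ι₁ (cmPlace (L : Type) ι₁) j)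
    (hcan : (InfinitePlace.mk ι₁).embedding = ι₁)
    (hn₁ : nV (cmPlaceOver (L : Type) (cmPlace (L : Type) ι₁)).1 = -(iotaVacExponents V S hGR hW hpos).eP)
    (x : Matrix.unitaryGroup (PosIdx (cmXV (L : Type) (frameD V) (frameD_real V) ι₁ (cmPlace (L : Type) ι₁))) ℂ ×
      Matrix.unitaryGroup (NegIdx (cmXV (L : Type) (frameD V) (frameD_real V) ι₁ (cmPlace (L : Type) ι₁))) ℂ) :
    ((cmDetTwistChar (L : Type) (frameD V) (frameD_ne V) (dW S) (dW_ne S) (charOfUnitaryLineChar (L : Type) χV)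
          (charOfUnitaryLineChar (L : Type) χW)
          (kPair V S ι₁ V.sylvesterFrame (sylvesterFrame_formCongr V)
            (lettInv V S (Pi.mulSingle (cmPlace (L : Type) ι₁) x))) : ℂˣ) : ℂ) *
        ((pinLetterChar V S hGR hW (kVLetters V S (Pi.mulSingle (cmPlace (L : Type) ι₁) x)) : Circle) : ℂ) * dVIota V S x =
      ((UnitaryGroup.archKappa (L : Type) V.Hm ι₁ V.sylvesterFrame (sylvesterFrame_formCongr V)
        (lettInv V S (Pi.mulSingle (cmPlace (L : Type) ι₁) x)) : ℂˣ) : ℂ) := by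
  revert x
  rw [hκ₁_iff_letterChar V S hGR hW χV χW hnV (iotaNegPt V)]
  intro x
  have ha : (x.1 : Matrix (PosIdx (cmXV (L : Type) (frameD V) (frameD_real V) ι₁ (cmPlace (L : Type) ι₁))) (PosIdx (cmXV (L : Type) (frameD V) (frameD_real V) ι₁ (cmPlace (L : Type) ι₁))) ℂ).det ≠ 0 :=
    (Matrix.UnitaryGroup.det_isUnit x.1).ne_zero
  have hd : (x.2 : Matrix (NegIdx (cmXV (L : Type) (frameD V) (frameD_real V) ι₁ (cmPlace (L : Type) ι₁))) (NegIdx (cmXV (L : Type) (frameD V) (frameD_real V) ι₁ (cmPlace (L : Type) ι₁))) ℂ).det ≠ 0 :=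
    (Matrix.UnitaryGroup.det_isUnit x.2).ne_zero
  rw [pinLetterChar_kVLetters_mulSingle_cmPlace_eq_det_zpow V S hGR hW hpos, dVIota_eq_det V S hpos, embTwist_apply_of_eq (L : Type) ι₁ hcan, hn₁,
    ← det_negLetter_eq V (iotaNegPt V), show (iotaVacExponents V S hGR hW hpos).eQ = (iotaVacExponents V S hGR hW hpos).eP - 2 by
      have h := iotaVacExponents_eP_sub_eQ V S hGR hW hpos; omega]
  exact zpow_bookkeeping ha hd _

end Iota

/-! ## §4 (V-val) on all of `K_∞` from the type equations (positive `W`-reading, canonical representative) -/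

section Val

variable {L : CMField} {ι₁ : L →+* ℂ} (V : HermSpace3 L ι₁) (S : StubTree.SeesawDatum L)
variable
  (hGR : (cmSplittingDatum (L : Type) finProdFinEquiv (frameD V) (frameD_real V) (frameD_ne V) (dW S) (dW_real S) (dW_ne S)).CompatibleSplitting)
  (hW : (∀ j, 0 < (ι₁ ((dW S) j)).re) ∨ ∀ j, (ι₁ ((dW S) j)).re < 0)
variable (χV χW : ContinuousMonoidHom
  (Literature.NumberTheory.Automorphic.relNormOneIdeles (↥(maximalRealSubfield L)) (L : Type) ⧸
    Literature.NumberTheory.Automorphic.relNormOneRat (↥(maximalRealSubfield L)) (L : Type)) Circle)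
variable {nV : InfinitePlace (L : Type) → ℤ}

/-- **(V-val) FROM THE TYPE EQUATIONS ALONE** (positive `W`-reading at `v₁`, canonical representative): at E's
`η = (χ_V ∘ det_V)·(χ_W ∘ det_W)` with `χ_V` of archimedean type `n_V` satisfying the (S-norm) equations
`n_V (w b) = −pairVacExponent b` (`b ≠ v₁`) and `n_V (w v₁) = −e_P(v₁)`, the rows-18/19 hypothesis `hκ` (#51/#61/#70/#71, verbatim) holds
for EVERY `k ∈ K_∞`. [GelbartRogawski1991, §3.1 Prop. 3.1.1, Remark p. 457; Folland1989, Prop. (4.39); KonnoKonno2007, Lemma 5.2] -/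
theorem hκ_of_type_of_pos (hnV : UnitaryLineChar.HasArchType (L : Type) χV nV)
    (hpos : ∀ j, 0 < cmXW (L : Type) (frameD V) (dW S) (dW_real S) ι₁ (cmPlace (L : Type) ι₁) j)
    (hcan : (InfinitePlace.mk ι₁).embedding = ι₁)
    (hn : ∀ b : {v : InfinitePlace ↥(maximalRealSubfield L) // v.IsReal}, b ≠ cmPlace (L : Type) ι₁ →
      nV (cmPlaceOver (L : Type) b).1 = -pairVacExponent V S hGR hW b)
    (hn₁ : nV (cmPlaceOver (L : Type) (cmPlace (L : Type) ι₁)).1 = -(iotaVacExponents V S hGR hW hpos).eP)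
    (k : ↥(KInfty V)) :
    ((cmDetTwistChar (L : Type) (frameD V) (frameD_ne V) (dW S) (dW_ne S) (charOfUnitaryLineChar (L : Type) χV)
          (charOfUnitaryLineChar (L : Type) χW) (kPair V S ι₁ V.sylvesterFrame (sylvesterFrame_formCongr V) k) : ℂˣ) : ℂ) *
        ((pinLetterChar V S hGR hW (kVLetters V S (lett V S k)) : Circle) : ℂ) * dVIota V S (lett V S k (cmPlace (L : Type) ι₁)) =
      ((UnitaryGroup.archKappa (L : Type) V.Hm ι₁ V.sylvesterFrame (sylvesterFrame_formCongr V) k : ℂˣ) : ℂ) :=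
  hκ_of_iota_of_type V S hGR hW χV χW hnV hn (hκ₁_of_type_of_pos V S hGR hW χV χW hnV hpos hcan hn₁) k

end Val

end HodgeCM.Model.HypCensus

end
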